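/- Width seat `ym-line-sfw-p2-w5` (prover-ym-line-sfw-p2-w5-g19-0), free hands on planner ym-idea-2 g17's STUB-PLAN-U1 rev 3 §7.3, item (J′2)
(coercivity on the skin) toward S3b `LandauKernelDecay` of LINE-19/LINE-20 (⟨stmt-QuantumFields-24004⟩ / ⟨24335⟩ / ⟨24336⟩). -/
import Summits.QuantumFields.YangMills.Theorems.AllWindowsColdBoxBoxHighLineHodgeRows
import Summits.QuantumFields.YangMills.Theorems.AllWindowsColdBoxBoxHighLineLandauMinimiser

/-!
# (J′2) of STUB-PLAN-U1 rev 3 §7.3: the Hodge form dominates the skin — `Σ_{s ∈ skin} v_s² ≤ vᵀ·hodgeQ·v`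

For the Hodge precision matrix `hodgeQ H = Σ_P λ_P λ_Pᵀ + Σ_{x interior} g_x g_xᵀ` of the cold box (✓`dotProduct_hodgeQ_mulVec`:
`vᵀ hodgeQ v = Σ_{P ∈ hodgePlaqs} (λ_P·v)² + Σ_x (g_x·v)²`), every SKIN link `s = (x, μ)` — a box link lying IN a face, i.e. `x_ν ∈ {0, 2H}` for some
`ν ≠ μ` — owns an OUTWARD plaquette `P_out(s) ∈ hodgePlaqs H` (base `x` resp. `x − e_ν`, plane `{μ, ν}`) whose three other edges leave the cube
`[0,2H]⁴` and are therefore pinned (`landauPin`), so that `λ_{P_out(s)} = ± δ_s` on the free edges (`exists_outward_plaquette`).  Distinct skin links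
have distinct outward plaquettes, and dropping all other (nonnegative) squares gives

  **`skin_sq_le_dotProduct_hodgeQ`**: `Σ_{s ∈ S} v_s² ≤ v ⬝ᵥ (hodgeQ H *ᵥ v)` for every finset `S` of skin links and every `v`,

i.e. `hodgeQ ≥ I_skin ⊕ 0_rest` as quadratic forms (planner ym-idea-2 g17, 14:58:05Z source check) — the input `(h3)`, `m₀ = 1`, of w2 g29's abstract
`schur_jaffard_decay` after the Schur step.  The skin is given as an inline predicate (no new definition) so that any indexing / `reindex` of the
skin–rest split can consume the statement.  Everything proved; no definition; standard axioms.  HONEST LABEL: helper toward the OPEN shared stub S3b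
of critic-PASSed DRAFT-by-design lines on the R2ξ″ RECORD-rung cruxes; no stub is proved by name, no crux, rung or summit is proved; the Yang–Mills mass
gap is NOT proved by this file.
-/

set_option autoImplicit false

noncomputable section

open Finset Matrix
open Literature.Probability.LatticeModels (Site mem_halfOpenBox halfOpenBox)
open Literature.MathematicalPhysics.QuantumFieldTheory hiding boxEdges
open Literature.MathematicalPhysics.QuantumFieldTheory.LatticeMaxwell
open Literature.MathematicalPhysics.QuantumFieldTheory.AxialGauge
open Summit.QuantumFields.YangMills.Theorems.WeakCouplingRates

namespace Summit.QuantumFields.YangMills.Theorems.AllWindowsColdBoxBoxHighLine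

variable {H : ℕ}

/-! ## The circulation coefficient of a plaquette with three pinned edges -/

/-- `coeffAux` on the first slot. -/
theorem coeffAux_slot_one {e : Literature.MathematicalPhysics.QuantumLattice.ZdEdge 4} {q : Plaq 4} (h1 : e = (q.1, q.2.1))
    (h2 : e ≠ (q.1 + Pi.single q.2.1 1, q.2.2)) (h3 : e ≠ (q.1 + Pi.single q.2.2 1, q.2.1)) (h4 : e ≠ (q.1, q.2.2)) :
    coeffAux e q = 1 := by
  unfold coeffAux; rw [if_pos h1, if_neg h2, if_neg h3, if_neg h4]; norm_num

/-- `coeffAux` on the second slot. -/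
theorem coeffAux_slot_two {e : Literature.MathematicalPhysics.QuantumLattice.ZdEdge 4} {q : Plaq 4} (h1 : e ≠ (q.1, q.2.1))
    (h2 : e = (q.1 + Pi.single q.2.1 1, q.2.2)) (h3 : e ≠ (q.1 + Pi.single q.2.2 1, q.2.1)) (h4 : e ≠ (q.1, q.2.2)) :
    coeffAux e q = 1 := by
  unfold coeffAux; rw [if_neg h1, if_pos h2, if_neg h3, if_neg h4]; norm_num

/-- `coeffAux` on the third slot. -/
theorem coeffAux_slot_three {e : Literature.MathematicalPhysics.QuantumLattice.ZdEdge 4} {q : Plaq 4} (h1 : e ≠ (q.1, q.2.1))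
    (h2 : e ≠ (q.1 + Pi.single q.2.1 1, q.2.2)) (h3 : e = (q.1 + Pi.single q.2.2 1, q.2.1)) (h4 : e ≠ (q.1, q.2.2)) :
    coeffAux e q = -1 := by
  unfold coeffAux; rw [if_neg h1, if_neg h2, if_pos h3, if_neg h4]; norm_num

/-- `coeffAux` on the fourth slot. -/
theorem coeffAux_slot_four {e : Literature.MathematicalPhysics.QuantumLattice.ZdEdge 4} {q : Plaq 4} (h1 : e ≠ (q.1, q.2.1))
    (h2 : e ≠ (q.1 + Pi.single q.2.1 1, q.2.2)) (h3 : e ≠ (q.1 + Pi.single q.2.2 1, q.2.1)) (h4 : e = (q.1, q.2.2)) :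
    coeffAux e q = -1 := by
  unfold coeffAux; rw [if_neg h1, if_neg h2, if_neg h3, if_pos h4]; norm_num

/-- A free edge differs from any edge that is not a cold-box edge. -/
theorem free_ne_of_not_mem (e : LandauFree H) {f : Literature.MathematicalPhysics.QuantumLattice.ZdEdge 4}
    (hf : f ∉ boxEdges 4 (2 * H + 1)) : e.1.1 ≠ f := fun h => hf (h ▸ free_mem_boxEdges e)

/-- Two free edges with the same underlying edge are equal. -/
theorem free_ext {e s : LandauFree H} (h : e.1.1 = s.1.1) : e = s := Subtype.ext (Subtype.ext h)

/-! ## The outward plaquette of a skin link -/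

/-- **Every skin link owns an outward plaquette of the Hodge system whose coefficient vector is `± δ_s`.**  For a free edge `s = (x, μ)` with
`x_ν ∈ {0, 2H}` for some `ν ≠ μ` there is `P ∈ hodgePlaqs H` and a sign `σ = ±1` with `λ_P(e) = σ·[e = s]` for every free edge `e`. -/
theorem exists_outward_plaquette (s : LandauFree H) {ν : Fin 4} (hν : ν ≠ s.1.1.2) (hface : s.1.1.1 ν = 0 ∨ s.1.1.1 ν = 2 * (H : ℤ)) :
    ∃ q ∈ hodgePlaqs H, ∃ σ : ℝ, σ ^ 2 = 1 ∧ ∀ e : LandauFree H, landauCoeff H q e = if e = s then σ else 0 := by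
  have hbox := mem_boxEdges_iff.1 (show (s.1.1.1, s.1.1.2) ∈ boxEdges 4 (2 * H + 1) from free_mem_boxEdges s)
  have hx : ∀ k, 0 ≤ s.1.1.1 k ∧ s.1.1.1 k ≤ 2 * (H : ℤ) := fun k => by have := hbox.1 k; push_cast at this; omega
  have hxμ : s.1.1.1 s.1.1.2 + 1 ≤ 2 * (H : ℤ) := by have := hbox.2; push_cast at this; omega
  have hs : s.1.1 = (s.1.1.1, s.1.1.2) := rfl
  -- the generic conclusion from: membership, the designated slot, the three pinned slots
  have conclude : ∀ (q : Plaq 4) (σ : ℝ), q ∈ hodgePlaqs H → σ ^ 2 = 1 → coeffAux s.1.1 q = σ →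
      (∀ f : Literature.MathematicalPhysics.QuantumLattice.ZdEdge 4, f ∈ boxEdges 4 (2 * H + 1) → f ≠ s.1.1 → coeffAux f q = 0) →
      ∃ q ∈ hodgePlaqs H, ∃ σ : ℝ, σ ^ 2 = 1 ∧ ∀ e : LandauFree H, landauCoeff H q e = if e = s then σ else 0 := by
    intro q σ hq hσ hval hother
    refine ⟨q, hq, σ, hσ, fun e => ?_⟩
    rw [landauCoeff_apply]
    by_cases he : e = s
    · rw [if_pos he, he, hval]
    · rw [if_neg he]
      exact hother e.1.1 (free_mem_boxEdges e) (fun h => he (free_ext h))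
  rcases lt_or_gt_of_ne hν with hlt | hgt
  · -- `ν < μ`
    rcases hface with h0 | h2H
    · -- bottom face `x_ν = 0`: `P = (x − e_ν; ν, μ)`, `s` is the second slot, `σ = +1`
      set q : Plaq 4 := (s.1.1.1 - Pi.single ν 1, (ν, s.1.1.2)) with hq
      have e2 : (q.1 + Pi.single q.2.1 1, q.2.2) = s.1.1 := by rw [hs, hq]; simp
      have n1 : (q.1, q.2.1) ∉ boxEdges 4 (2 * H + 1) := not_mem_boxEdges_of_fst ⟨ν, Or.inl (by rw [hq]; simp [h0])⟩
      have n3 : (q.1 + Pi.single q.2.2 1, q.2.1) ∉ boxEdges 4 (2 * H + 1) :=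
        not_mem_boxEdges_of_fst ⟨ν, Or.inl (by rw [hq]; simp [h0, Pi.single_eq_of_ne hν])⟩
      have n4 : (q.1, q.2.2) ∉ boxEdges 4 (2 * H + 1) := not_mem_boxEdges_of_fst ⟨ν, Or.inl (by rw [hq]; simp [h0])⟩
      refine conclude q 1 ?_ (by norm_num) ?_ ?_
      · show q ∈ (plaquettesIn (halfOpenBox 4 (2 * H + 3))).image (Plaq.shift dirCorner)
        rw [mem_image_shift_iff]
        refine ⟨hlt, fun k => ?_, fun k => ?_⟩
        · rw [hq]; by_cases hk : k = ν
          · subst hk; simp [h0]; omega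
          · have := hx k; simp [Pi.single_eq_of_ne hk]; omega
        · rw [hq]
          simp only [sub_add_cancel, Pi.add_apply]
          by_cases hk : k = s.1.1.2
          · subst hk; simp only [Pi.single_eq_same]; omega
          · have := hx k; simp only [Pi.single_eq_of_ne hk]; omega
      · exact coeffAux_slot_two (fun h => n1 (h ▸ free_mem_boxEdges s)) e2.symm (fun h => n3 (h ▸ free_mem_boxEdges s))
          (fun h => n4 (h ▸ free_mem_boxEdges s))
      · intro f hf hfs
        exact coeffAux_eq_zero (by
          push Not
          exact ⟨fun h => n1 (h ▸ hf), fun h => hfs (h.symm.trans e2) , fun h => n3 (h ▸ hf), fun h => n4 (h ▸ hf)⟩)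
    · -- top face `x_ν = 2H`: `P = (x; ν, μ)`, `s` is the fourth slot, `σ = −1`
      set q : Plaq 4 := (s.1.1.1, (ν, s.1.1.2)) with hq
      have e4 : (q.1, q.2.2) = s.1.1 := by rw [hs, hq]
      have n1 : (q.1, q.2.1) ∉ boxEdges 4 (2 * H + 1) := not_mem_boxEdges_of_snd ⟨ν, Or.inr (by rw [hq]; simp [h2H])⟩
      have n2 : (q.1 + Pi.single q.2.1 1, q.2.2) ∉ boxEdges 4 (2 * H + 1) :=
        not_mem_boxEdges_of_fst ⟨ν, Or.inr (by rw [hq]; simp [h2H])⟩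
      have n3 : (q.1 + Pi.single q.2.2 1, q.2.1) ∉ boxEdges 4 (2 * H + 1) :=
        not_mem_boxEdges_of_snd ⟨ν, Or.inr (by rw [hq]; simp [h2H, Pi.single_eq_of_ne hν])⟩
      refine conclude q (-1) ?_ (by norm_num) ?_ ?_
      · show q ∈ (plaquettesIn (halfOpenBox 4 (2 * H + 3))).image (Plaq.shift dirCorner)
        rw [mem_image_shift_iff]
        refine ⟨hlt, fun k => ?_, fun k => ?_⟩
        · rw [hq]; have := hx k; simp only; omega
        · rw [hq]
          simp only [Pi.add_apply]
          by_cases hk : k = ν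
          · subst hk; simp only [Pi.single_eq_same, Pi.single_eq_of_ne hν]; omega
          · by_cases hk' : k = s.1.1.2
            · subst hk'; simp only [Pi.single_eq_same, Pi.single_eq_of_ne (Ne.symm hν)]; omega
            · have := hx k; simp only [Pi.single_eq_of_ne hk, Pi.single_eq_of_ne hk']; omega
      · exact coeffAux_slot_four (fun h => n1 (h ▸ free_mem_boxEdges s)) (fun h => n2 (h ▸ free_mem_boxEdges s))
          (fun h => n3 (h ▸ free_mem_boxEdges s)) e4.symm
      · intro f hf hfs
        exact coeffAux_eq_zero (by
          push Not
          exact ⟨fun h => n1 (h ▸ hf), fun h => n2 (h ▸ hf), fun h => n3 (h ▸ hf), fun h => hfs (h.symm.trans e4)⟩)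
  · -- `μ < ν`
    rcases hface with h0 | h2H
    · -- bottom face `x_ν = 0`: `P = (x − e_ν; μ, ν)`, `s` is the third slot, `σ = −1`
      set q : Plaq 4 := (s.1.1.1 - Pi.single ν 1, (s.1.1.2, ν)) with hq
      have e3 : (q.1 + Pi.single q.2.2 1, q.2.1) = s.1.1 := by rw [hs, hq]; simp
      have n1 : (q.1, q.2.1) ∉ boxEdges 4 (2 * H + 1) := not_mem_boxEdges_of_fst ⟨ν, Or.inl (by rw [hq]; simp [h0])⟩
      have n2 : (q.1 + Pi.single q.2.1 1, q.2.2) ∉ boxEdges 4 (2 * H + 1) :=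
        not_mem_boxEdges_of_fst ⟨ν, Or.inl (by rw [hq]; simp [h0, Pi.single_eq_of_ne hν])⟩
      have n4 : (q.1, q.2.2) ∉ boxEdges 4 (2 * H + 1) := not_mem_boxEdges_of_fst ⟨ν, Or.inl (by rw [hq]; simp [h0])⟩
      refine conclude q (-1) ?_ (by norm_num) ?_ ?_
      · show q ∈ (plaquettesIn (halfOpenBox 4 (2 * H + 3))).image (Plaq.shift dirCorner)
        rw [mem_image_shift_iff]
        refine ⟨hgt, fun k => ?_, fun k => ?_⟩
        · rw [hq]; by_cases hk : k = ν
          · subst hk; simp [h0]; omega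
          · have := hx k; simp [Pi.single_eq_of_ne hk]; omega
        · rw [hq]
          simp only [Pi.add_apply, Pi.sub_apply]
          by_cases hk : k = ν
          · subst hk; simp only [Pi.single_eq_same, Pi.single_eq_of_ne hν]; omega
          · by_cases hk' : k = s.1.1.2
            · subst hk'; simp only [Pi.single_eq_same, Pi.single_eq_of_ne (Ne.symm hν)]; omega
            · have := hx k; simp only [Pi.single_eq_of_ne hk, Pi.single_eq_of_ne hk']; omega
      · exact coeffAux_slot_three (fun h => n1 (h ▸ free_mem_boxEdges s)) (fun h => n2 (h ▸ free_mem_boxEdges s)) e3.symm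
          (fun h => n4 (h ▸ free_mem_boxEdges s))
      · intro f hf hfs
        exact coeffAux_eq_zero (by
          push Not
          exact ⟨fun h => n1 (h ▸ hf), fun h => n2 (h ▸ hf), fun h => hfs (h.symm.trans e3), fun h => n4 (h ▸ hf)⟩)
    · -- top face `x_ν = 2H`: `P = (x; μ, ν)`, `s` is the first slot, `σ = +1`
      set q : Plaq 4 := (s.1.1.1, (s.1.1.2, ν)) with hq
      have e1 : (q.1, q.2.1) = s.1.1 := by rw [hs, hq]
      have n2 : (q.1 + Pi.single q.2.1 1, q.2.2) ∉ boxEdges 4 (2 * H + 1) :=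
        not_mem_boxEdges_of_snd ⟨ν, Or.inr (by rw [hq]; simp [h2H, Pi.single_eq_of_ne hν])⟩
      have n3 : (q.1 + Pi.single q.2.2 1, q.2.1) ∉ boxEdges 4 (2 * H + 1) :=
        not_mem_boxEdges_of_fst ⟨ν, Or.inr (by rw [hq]; simp [h2H])⟩
      have n4 : (q.1, q.2.2) ∉ boxEdges 4 (2 * H + 1) := not_mem_boxEdges_of_snd ⟨ν, Or.inr (by rw [hq]; simp [h2H])⟩
      refine conclude q 1 ?_ (by norm_num) ?_ ?_
      · show q ∈ (plaquettesIn (halfOpenBox 4 (2 * H + 3))).image (Plaq.shift dirCorner)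
        rw [mem_image_shift_iff]
        refine ⟨hgt, fun k => ?_, fun k => ?_⟩
        · rw [hq]; have := hx k; simp only; omega
        · rw [hq]
          simp only [Pi.add_apply]
          by_cases hk : k = ν
          · subst hk; simp only [Pi.single_eq_same, Pi.single_eq_of_ne hν]; omega
          · by_cases hk' : k = s.1.1.2
            · subst hk'; simp only [Pi.single_eq_same, Pi.single_eq_of_ne (Ne.symm hν)]; omega
            · have := hx k; simp only [Pi.single_eq_of_ne hk, Pi.single_eq_of_ne hk']; omega
      · exact coeffAux_slot_one e1.symm (fun h => n2 (h ▸ free_mem_boxEdges s)) (fun h => n3 (h ▸ free_mem_boxEdges s))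
          (fun h => n4 (h ▸ free_mem_boxEdges s))
      · intro f hf hfs
        exact coeffAux_eq_zero (by
          push Not
          exact ⟨fun h => hfs (h.symm.trans e1), fun h => n2 (h ▸ hf), fun h => n3 (h ▸ hf), fun h => n4 (h ▸ hf)⟩)

/-! ## The coercivity on the skin -/

/-- **(J′2) — the Hodge form dominates the skin**: for every finset `S` of skin links (box links `(x, μ)` with `x_ν ∈ {0, 2H}` for some
`ν ≠ μ`) and every `v`, `Σ_{s ∈ S} v_s² ≤ v ⬝ᵥ (hodgeQ H *ᵥ v)`; i.e. `hodgeQ ≥ I_skin ⊕ 0_rest` as quadratic forms. -/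
theorem skin_sq_le_dotProduct_hodgeQ (H : ℕ) (v : LandauFree H → ℝ) (S : Finset (LandauFree H))
    (hS : ∀ s ∈ S, ∃ ν : Fin 4, ν ≠ s.1.1.2 ∧ (s.1.1.1 ν = 0 ∨ s.1.1.1 ν = 2 * (H : ℤ))) :
    ∑ s ∈ S, v s ^ 2 ≤ v ⬝ᵥ (hodgeQ H *ᵥ v) := by
  classical
  -- choose an outward plaquette for every skin link (junk elsewhere)
  have hex : ∀ s : LandauFree H, ∃ q : Plaq 4, s ∈ S →
      (q ∈ hodgePlaqs H ∧ ∃ σ : ℝ, σ ^ 2 = 1 ∧ ∀ e : LandauFree H, landauCoeff H q e = if e = s then σ else 0) := by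
    intro s
    by_cases hs : s ∈ S
    · obtain ⟨ν, hν, hface⟩ := hS s hs
      obtain ⟨q, hq, σ, hσ, hcoef⟩ := exists_outward_plaquette s hν hface
      exact ⟨q, fun _ => ⟨hq, σ, hσ, hcoef⟩⟩
    · exact ⟨(0, (0, 0)), fun h => absurd h hs⟩
  choose P hP using hex
  -- `(λ_{P s} · v)² = v_s²`
  have hsq : ∀ s ∈ S, (landauCoeff H (P s) ⬝ᵥ v) ^ 2 = v s ^ 2 := by
    intro s hs
    obtain ⟨-, σ, hσ, hcoef⟩ := hP s hs
    have hdot : landauCoeff H (P s) ⬝ᵥ v = σ * v s := by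
      rw [dotProduct, Finset.sum_eq_single s]
      · rw [hcoef s, if_pos rfl]
      · intro e _ hne; rw [hcoef e, if_neg hne, zero_mul]
      · intro h; exact absurd (Finset.mem_univ s) h
    rw [hdot, mul_pow, hσ, one_mul]
  -- `P` is injective on `S`
  have hinj : Set.InjOn P S := by
    intro s hs s' hs' hPP
    obtain ⟨-, σ, hσ, hcoef⟩ := hP s hs
    obtain ⟨-, σ', -, hcoef'⟩ := hP s' hs'
    have h1 := hcoef s
    rw [if_pos rfl, hPP, hcoef' s] at h1
    by_contra hne
    rw [if_neg hne] at h1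
    have : σ ^ 2 = 0 := by rw [← h1]; ring
    rw [hσ] at this
    exact one_ne_zero this
  -- drop the other squares
  have hsub : S.image P ⊆ hodgePlaqs H := fun q hq => by
    obtain ⟨s, hs, rfl⟩ := Finset.mem_image.1 hq
    exact (hP s hs).1
  have hA1 : ∑ s ∈ S, v s ^ 2 = ∑ s ∈ S, (landauCoeff H (P s) ⬝ᵥ v) ^ 2 :=
    Finset.sum_congr rfl fun s hs => (hsq s hs).symm
  have hA2 : ∑ q ∈ S.image P, (landauCoeff H q ⬝ᵥ v) ^ 2 = ∑ s ∈ S, (landauCoeff H (P s) ⬝ᵥ v) ^ 2 :=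
    Finset.sum_image hinj
  have hA3 : ∑ q ∈ S.image P, (landauCoeff H q ⬝ᵥ v) ^ 2 ≤ ∑ q ∈ hodgePlaqs H, (landauCoeff H q ⬝ᵥ v) ^ 2 :=
    Finset.sum_le_sum_of_subset_of_nonneg hsub fun q _ _ => sq_nonneg _
  have hB : ∑ q ∈ hodgePlaqs H, (landauCoeff H q ⬝ᵥ v) ^ 2 ≤ v ⬝ᵥ (hodgeQ H *ᵥ v) := by
    have h0 : 0 ≤ ∑ x ∈ interiorSites H, (gradVec H x ⬝ᵥ v) * (gradVec H x ⬝ᵥ v) :=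
      Finset.sum_nonneg fun x _ => mul_self_nonneg _
    rw [dotProduct_hodgeQ_mulVec]
    have h1 : ∑ q ∈ hodgePlaqs H, (landauCoeff H q ⬝ᵥ v) ^ 2 =
        ∑ q ∈ hodgePlaqs H, (landauCoeff H q ⬝ᵥ v) * (landauCoeff H q ⬝ᵥ v) :=
      Finset.sum_congr rfl fun q _ => sq _
    rw [h1]
    exact le_add_of_nonneg_right h0
  rw [hA1, ← hA2]
  exact hA3.trans hB

end Summit.QuantumFields.YangMills.Theorems.AllWindowsColdBoxBoxHighLine

end
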